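import Mathlib.Analysis.Complex.Basic
import Literature.Analysis.FunctionSpaces.ContDiffHolderLocalization
import Literature.Analysis.FunctionSpaces.HolderChartRestriction
import HarnessLib

/-!
# Local-to-global gluing of Hölder classes by partitions of unity (Hölder spaces, part 29)

Topic `Literature/Analysis/FunctionSpaces`. The classes `C^{k,r}_b(E, F)` (`MemContDiffHolder k r`,
parts 1, 3) are global, while regularity statements are usually obtained locally, in the form

  `∃ W, MemContDiffHolder k r W ∧ W =ᶠ[𝓝 x] g`     ("`g` is of class `C^{k,r}` near `x`").

This file records the standard passage from local to global on a finite-dimensional space `E`: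

* `MemContDiffHolder.cutoff_smul_of_forall_exists` — if `g` is of class `C^{k,r}` near every point
  of the support of a `C^∞` cutoff `χ` with compact support, then `χ • g ∈ C^{k,r}_b(E, F)`
  (`r ≤ 1`): cover `tsupport χ` by finitely many open sets on which `g` agrees with members `W_i`,
  take a smooth partition of unity `ψ_i` on `tsupport χ` subordinate to the cover
  (`SmoothPartitionOfUnity.exists_isSubordinate`) and write `χ • g = ∑ i, (χ ψ_i) • W_i`, a finite
  sum of cutoffs times members;
* `MemContDiffHolder.cutoff_smul_of_forall_exists_complex` — the same for the complex scalar
  action of the real cutoff on a complex Banach space;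
* `exists_memContDiffHolder_smul_comp_inv` — **transport through `w = 1/z`**: if `u` is of class
  `C^{m,r}` near `w₀ ≠ 0` and `a : ℂ → ℂ` is smooth off the origin, then `z ↦ a z • u z⁻¹` is of
  class `C^{m,r}` near `w₀⁻¹` (localized pre-composition with the inversion, part 10).

These are the gluing steps of the chart-piece calculus of Hölder spaces on compact manifolds
(Gilbarg–Trudinger 2001, §6.2; Joyce 2007, §1.2), used for sections of line bundles over the
Riemann sphere `ℂ_z ∪ ℂ_w`. Everything is proved; no named facts. Spaces are taken in universe `0`
(the tree's Leibniz estimate, part 5, is one-universe and `ℝ : Type`).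

## References

* D. Gilbarg, N. S. Trudinger, *Elliptic Partial Differential Equations of Second Order* (2001),
  §4.1, §6.2. [GilbargTrudinger2001]
* D. D. Joyce, *Riemannian Holonomy Groups and Calibrated Geometry* (2007), §1.2. [Joyce2007]
-/

noncomputable section

open Set Filter Metric Topology
open scoped NNReal Manifold ContDiff

namespace Literature.Analysis.FunctionSpaces

/-! ### Gluing local members along a compactly supported cutoff -/

section Real

variable {E F : Type} [NormedAddCommGroup E] [NormedSpace ℝ E] [FiniteDimensional ℝ E]
  [NormedAddCommGroup F] [NormedSpace ℝ F] {k : ℕ} {r : ℝ≥0}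

/-- **Local-to-global gluing**: if `g : E → F` agrees near every point of the support of a `C^∞`
cutoff `χ` with compact support with some member of `C^{k,r}_b(E, F)`, then
`χ • g ∈ C^{k,r}_b(E, F)` (`r ≤ 1`; finite subcover of `tsupport χ`, smooth partition of unity
subordinate to it, `χ • g = ∑ i, (χ ψ_i) • W_i`). [cite: GilbargTrudinger2001, §6.2] -/
theorem MemContDiffHolder.cutoff_smul_of_forall_exists (hr : r ≤ 1) {g : E → F} {χ : E → ℝ}
    (hχ : ContDiff ℝ ∞ χ) (hχs : HasCompactSupport χ)
    (h : ∀ x ∈ tsupport χ, ∃ W : E → F, MemContDiffHolder k r W ∧ W =ᶠ[𝓝 x] g) :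
    MemContDiffHolder k r fun x => χ x • g x := by
  choose! W hW hWg using h
  -- the open sets on which `g` agrees with the local members, indexed by `tsupport χ`
  set U : tsupport χ → Set E := fun x => {y | ∀ᶠ z in 𝓝 y, W x z = g z}
  have hUo : ∀ x, IsOpen (U x) := fun x => isOpen_setOf_eventually_nhds
  have hKU : tsupport χ ⊆ ⋃ x, U x := fun x hx => mem_iUnion.2 ⟨⟨x, hx⟩, hWg x hx⟩
  -- a finite subcover and a smooth partition of unity subordinate to it
  obtain ⟨t, ht⟩ := hχs.elim_finite_subcover U hUo hKU
  have hKt : tsupport χ ⊆ ⋃ i : t, U i := by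
    intro y hy
    obtain ⟨i, hi, hyi⟩ := mem_iUnion₂.1 (ht hy)
    exact mem_iUnion.2 ⟨⟨i, hi⟩, hyi⟩
  obtain ⟨ψ, hψU⟩ := SmoothPartitionOfUnity.exists_isSubordinate 𝓘(ℝ, E) (isClosed_tsupport χ)
    (fun i : t => U i) (fun i => hUo i) hKt
  -- each summand `(χ ψ_i) • W_i` is a member
  have hψ : ∀ i : t, ContDiff ℝ ∞ fun y => χ y * ψ i y := fun i =>
    hχ.mul (contMDiff_iff_contDiff.1 (ψ i).contMDiff)
  have hmem : ∀ i : t, MemContDiffHolder k r fun y => (χ y * ψ i y) • W i y := fun i =>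
    (MemContDiffHolder.of_contDiff_of_hasCompactSupport (hψ i) hχs.mul_right hr).bilinear hr
      (ContinuousLinearMap.lsmul ℝ ℝ) (hW _ i.1.2)
  -- and `χ • g` is their sum
  have heq : (fun y => χ y • g y) = fun y => ∑ i : t, (χ y * ψ i y) • W i y := by
    funext y
    by_cases hy : χ y = 0
    · simp [hy]
    have hyK : y ∈ tsupport χ := subset_closure (Function.mem_support.2 hy)
    have hsum : ∑ i : t, ψ i y = 1 := by
      rw [← finsum_eq_sum_of_fintype]
      exact ψ.sum_eq_one hyK
    have hterm : ∀ i : t, (χ y * ψ i y) • W i y = (χ y * ψ i y) • g y := by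
      intro i
      by_cases hi : ψ i y = 0
      · simp [hi]
      · have hyU : y ∈ U i := hψU i (subset_closure (Function.mem_support.2 hi))
        rw [show W i y = g y from hyU.self_of_nhds]
    simp_rw [hterm, ← Finset.sum_smul, ← Finset.mul_sum, hsum, mul_one]
  rw [heq]
  exact MemContDiffHolder.finset_sum _ fun i _ => hmem i

end Real

/-! ### Complex scalars -/

section Complex

variable {E F : Type} [NormedAddCommGroup E] [NormedSpace ℝ E] [FiniteDimensional ℝ E]
  [NormedAddCommGroup F] [NormedSpace ℂ F] {k : ℕ} {r : ℝ≥0}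

/-- **Local-to-global gluing, complex scalars**: for a complex Banach space `F` and a real cutoff
`χ` acting through `ℝ ⊆ ℂ`, if `g` agrees near every point of `tsupport χ` with a member of
`C^{k,r}_b(E, F)` then `z ↦ (χ z : ℂ) • g z` is a member (`r ≤ 1`).
[cite: GilbargTrudinger2001, §6.2] -/
theorem MemContDiffHolder.cutoff_smul_of_forall_exists_complex (hr : r ≤ 1) {g : E → F}
    {χ : E → ℝ} (hχ : ContDiff ℝ ∞ χ) (hχs : HasCompactSupport χ)
    (h : ∀ x ∈ tsupport χ, ∃ W : E → F, MemContDiffHolder k r W ∧ W =ᶠ[𝓝 x] g) :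
    MemContDiffHolder k r fun x => (χ x : ℂ) • g x := by
  have heq : (fun x => (χ x : ℂ) • g x) = fun x => χ x • g x :=
    funext fun x => Complex.coe_smul _ _
  rw [heq]
  exact MemContDiffHolder.cutoff_smul_of_forall_exists hr hχ hχs h

end Complex

/-! ### Transport through the inversion `w = 1/z` -/

section Inversion

variable {F : Type} [NormedAddCommGroup F] [NormedSpace ℂ F] {m : ℕ} {r : ℝ≥0}

/-- **Transport of a local Hölder class through `w = 1/z`**: if `u : ℂ → F` is of class `C^{m,r}`
near `w₀ ≠ 0` and the coefficient `a : ℂ → ℂ` is `C^∞` off the origin, then `z ↦ a z • u z⁻¹` is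
of class `C^{m,r}` near `w₀⁻¹` (`r ≤ 1`). The witness is `(χ a) • (χ • (W ∘ inv))` for a bump `χ`
equal to `1` near `w₀⁻¹` with compact support off the origin (localized pre-composition with the
inversion, then a smooth compactly supported complex coefficient). [cite: Joyce2007, §1.2] -/
theorem exists_memContDiffHolder_smul_comp_inv (hr : r ≤ 1) {u : ℂ → F} {w₀ : ℂ}
    (hw₀ : w₀ ≠ 0) (hu : ∃ W, MemContDiffHolder m r W ∧ W =ᶠ[𝓝 w₀] u) {a : ℂ → ℂ}
    (ha : ContDiffOn ℝ ∞ a {z : ℂ | z ≠ 0}) :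
    ∃ W', MemContDiffHolder m r W' ∧ W' =ᶠ[𝓝 w₀⁻¹] fun z => a z • u z⁻¹ := by
  obtain ⟨W, hW, hWu⟩ := hu
  have hz₀ : w₀⁻¹ ≠ 0 := inv_ne_zero hw₀
  have hO : IsOpen {z : ℂ | z ≠ 0} := isOpen_ne
  have hinv : ContDiffOn ℝ ∞ (fun z : ℂ => z⁻¹) {z | z ≠ 0} := fun z hz =>
    ((contDiffAt_inv ℂ hz).restrict_scalars ℝ).contDiffWithinAt
  obtain ⟨χ, hχ, hχs, hχO, hχ1, -⟩ := exists_contDiff_one_nhdsSet_of_isCompact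
    (isCompact_singleton (x := w₀⁻¹)) hO (singleton_subset_iff.2 hz₀)
  -- the localized pre-composition `χ • (W ∘ inv)` and the coefficient `χ a`
  have hV : MemContDiffHolder m r fun z => χ z • W z⁻¹ :=
    MemContDiffHolder.smul_comp_of_contDiffOn hr hW hO hinv hχ hχs hχO
  have ha' : ContDiff ℝ ∞ fun z => χ z • a z := ContDiff.smul_of_contDiffOn hχ hO ha hχO
  have ha's : HasCompactSupport fun z => χ z • a z := hχs.smul_right
  have ha'mem : MemContDiffHolder m r fun z => χ z • a z :=
    MemContDiffHolder.of_contDiff_of_hasCompactSupport ha' ha's hr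
  refine ⟨fun z => (ContinuousLinearMap.lsmul ℝ ℂ : ℂ →L[ℝ] F →L[ℝ] F) (χ z • a z) (χ z • W z⁻¹),
    ha'mem.bilinear hr (ContinuousLinearMap.lsmul ℝ ℂ) hV, ?_⟩
  -- near `w₀⁻¹`: `χ = 1` and `W ∘ inv = u ∘ inv`
  have h1 : ∀ᶠ z in 𝓝 w₀⁻¹, χ z = 1 := by
    rw [← nhdsSet_singleton]
    exact hχ1
  have h2 : ∀ᶠ z in 𝓝 w₀⁻¹, W z⁻¹ = u z⁻¹ := by
    have ht : Tendsto (fun z : ℂ => z⁻¹) (𝓝 w₀⁻¹) (𝓝 w₀) := by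
      simpa only [inv_inv] using tendsto_inv₀ hz₀
    exact ht.eventually hWu
  filter_upwards [h1, h2] with z hz1 hz2
  simp [hz1, hz2]

end Inversion

end Literature.Analysis.FunctionSpaces

end
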